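import Summits.QuantumFields.BalabanUV.Beta.FP.PerfectSymbolKMultiplier
import Literature.MathematicalPhysics.QuantumFieldTheory.Balaban1983to89.Beta.SecondOrderResponse

/-!
# `BalabanUV.Beta.FP.PerfectMultiplierBlockLift` — road «FP» for binder row D1, row **N2a-ENG v2**, input **(K-mm)** (owner d1-p3 gen 13,
# `N2B-DESIGN.md` v1.3 §7 ∕ journal l.32289: «(K-mm) the multiplier–multiplier block law … at the kernel level — TO BE TYPED»):
# **THE MULTIPLIER–MULTIPLIER BLOCK OF THE `(m+1)`-FOLD RESOLVENT IS THE LIFTED MULTIPLIER–MULTIPLIER BLOCK OF THE `m`-FOLD RESOLVENT, EXACTLY** —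
# finite level (every `d`, `Lc ≥ 1`, every `j`): `mmPart (KTot (Lc^(j+m+1)) (Lc^j)) = liftW Lc false false (KTot (Lc^(j+m+1)) (Lc^(j+1)))`, in the
# adopted units with the `j`-FREE factor `(Lc^{2(d+1)})⁻¹`; perfect level (`d + 1 = 4`, `Lc ≥ 2`, every `m`, UNCONDITIONAL): BOTTOM form
# `mmPart (KPerf … (m+1)) = (Lc⁸)⁻¹ • liftW Lc false false (KPerf … m)` and TOP form `mmPart (KPerf … (m+1)) = (Lc^{8m})⁻¹ • liftW (Lc^m) false false (KPerf … 1)`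
# — an EXACT kernel identity with its own transported term and NO deviation words (`D_mm m = 0` in the owner's `D m = D_E m + D_mm m`)

HONEST DEPENDENCY (page 1, mandatory): continuum YM on T⁴ ⇐ BetaPertH ∧ nine spine estimates (0/9 proved); BetaPertH ⇐ (D1) ∧ (D4) ∧ CAP+tail;
G-an2-4 gates asym, D1 and NE2/3/4.  HONEST FRAMING (cell contract, verbatim): «discharging `BetaPertH` makes Bałaban's UV stability UNCONDITIONAL —
a real constructive-QFT result; it is NOT the continuum limit and NOT the Clay problem.»  THIS MODULE is [folklore]-grade lattice bookkeeping over the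
tree's typed objects BY NAME: `FP.PerfectObjects.KTot` ∕ `KTot_shift` (finite-level stationarity), `OneStepKernelFamily.dec` (multiplier legs are READ at the
coarse points), an2's `InterLevelTransport.lift` ∕ `liftW` (`slotW false = 1`), gan24's `TransverseDictionary.mmPart` and `ScaleNesting.proj_mul_eq_zero_iff` ∕
`quo_mul`, leaf-06's `FP.ConvergenceJMMultiplier.KTot_inr_inr` (the mm block vanishes off the coarse points) and gan24-p3-g12's `FP.PerfectSymbolKMultiplier.KPerf_inr_inr_eq`
(the perfect mm block is `(2∕Lc^{8m})·Δ_∞` at the `Lc^m`-coarse points, `0` elsewhere).  No `def`, no `def … : Prop`, nothing cited, 0 sorry; no estimate;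
0∕4 row-D1 binders; discharges NO (CONV-C) row and NO table letter; NOT N2a (one input of its word list), NOT SDF, NOT D1, NOT BetaPertH, NOT continuum,
NOT Clay.  «not in print; our bookkeeping» (orientation only: [B12] (1.66) `Δ_k` and an5's `SliceComposition.toBlocks₁₁_effForm_comp_slice` «effective forms
compose on the physical corner» — the abstract identity of which this is the typed-kernel shadow at `U = 1`; nothing printed is used).

ABSOLUTE RULE (cell charter, verbatim): «No internally-minted statement may enter as a cited fact. Every hypothesis is either kernel-proved in this
package or a verbatim quotation of a PUBLISHED theorem with page reference. The manuscript(s) under audit are NOT citable for their own disputed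
steps — they are the thing under adjudication; programme-internal (2001/route/tribunal) claims are never citable.»

WHY (owner's N2a-ENG v2 shape, `N2B-DESIGN.md` v1.3 §7).  The one-loop Fubini expansion at the perfect objects splits every block of `A_{m+1} := KPerf … (m+1)`
in BOTTOM form `(M, L) = (one step, m-fold)`: (K-ff) `[A_{m+1}]_ff = [A_1]_ff + T♭_m + E♭_m` (gan24-leaf-05 `kPerf_pair_telescoping_bottom`, owner
`PerfectGaugeDefectBottom`), (K-fm) `colH A_{m+1} (Lc^{m+1}) = colH A_1 Lc ∘ liftW Lc (colH A_m (Lc^m))` (owner `kPerf_column_semigroup`), and (K-mm) — THIS FILE.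
In the tree's encoding `KTot n M := dec M (KInv n)` the tower property of constrained Gaussian steps (an5: blocks compose in the composed slice; the
`(j, m)`-resolvent IS the `m`-fold step's resolvent above level `j`) is built in, and on MULTIPLIER legs the decimation `dec` is evaluation at the coarse
points (`legSet (inr) = {0}`, `legW (inr) = 1`); so the mm block of the `(j, m+1)`-resolvent and that of the `(j+1, m)`-resolvent are ONE kernel
(`KTot_shift`), which in the fine coordinates is the statement `mmPart (KTot (Lc^(j+m+1)) (Lc^j)) = liftW Lc false false (KTot (Lc^(j+m+1)) (Lc^(j+1)))` —
with NO correction term (contrast (K-ff), whose naive entrywise shape is false by the gauge-slice defect, an5's `K1a′`).  At the perfect level the same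
identity holds with the adopted-unit factor `(Lc^{2(d+1)})⁻¹ = Lc⁻⁸` (`d = 3`), by gan24-p3's explicit symbol: the mm block of `KPerf … m` is `(2∕Lc^{8m})·Δ_∞`
for EVERY `m` — self-similar.  So the (K-mm) law the owner's word list consumes is EXACT: `D_mm m = 0`.

CONTENT.
* §1 (every `d`, `Lc ≥ 1`): `dec_inr_inr` (on multiplier legs `dec M K x′ y′ = K (M•x′) (M•y′)`), `liftW_false_false_inr_inr` (the weighted lift with two
  multiplier slots reads the mm block at the `M`-coarse points, `0` off them), `proj_pow_succ_ne` (off the `Lc`-lattice ⟹ off the `Lc^(m+1)`-lattice),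
  `KTot_inr_inr_off_fine` (the mm block of the `(j, m+1)`-resolvent vanishes off the `Lc`-lattice).
* §2 (every `d`, `Lc ≥ 1`, every `j m`): **`mmPart_KTot_eq_liftW`** — `mmPart (KTot (Lc^(j+m+1)) (Lc^j)) = liftW Lc false false (KTot (Lc^(j+m+1)) (Lc^(j+1)))`;
  `smStep_succ_sq`; **`mmPart_unitK_KTot_eq_liftW`** — the same for the unit-rescaled families with the `j`-FREE factor `((Lc:ℝ)^(2(d+1)))⁻¹`
  (levels `j` resp. `j+1` in their OWN adopted units `(sfStep, smStep d)`).
* §3 (`d + 1 = 4`, `2 ≤ Lc`, every `m`; UNCONDITIONAL): **`mmPart_KPerf_succ_eq_liftW`** (BOTTOM: `mmPart (KPerf Lc (sfStep Lc) (smStep 3 Lc) (m+1)) =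
  ((Lc:ℝ)^8)⁻¹ • liftW Lc false false (KPerf … m)`), **`mmPart_KPerf_succ_eq_liftW_one`** (TOP: `= ((Lc:ℝ)^(8m))⁻¹ • liftW (Lc^m) false false (KPerf … 1)`),
  `KPerf_succ_inr_inr_coarse` (at the `Lc^(m+1)`-coarse points: `[KPerf (m+1)]_mm (Lc^(m+1)•u, Lc^(m+1)•u′) = (Lc⁸)⁻ᵐ · [KPerf 1]_mm (Lc•u, Lc•u′)`).
* §4 (the currency an1's second-order carrier actually reads — `SecondOrderResponse.colM`, the multiplier column feeding `vertexOfM` ∕ `dM` ∕ `K2OfK` ∕ `W2OfK`, hence leaf-02's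
  `WtInf … (m+1) = W2SymOfK (KPerf (m+1)) (Lc^(m+1)) …`): **`colM_KPerf_succ`** (`colM (KPerf … (m+1)) (Lc^(m+1)) μ y ρ w = (Lc⁸)⁻¹ · colM (KPerf … m) (Lc^m) μ y ρ w` — the
  multiplier columns of the perfect resolvents are SELF-SIMILAR, one step = one factor `Lc⁻⁸`), **`colM_KPerf_succ_eq_one`** (`= (Lc^{8m})⁻¹ · colM (KPerf … 1) Lc μ y ρ w`).
Provenance: D1 formalisation swarm LEAF PROVER 06, unit b2b-balaban-beta-d1-formalise-leaf-06 gen 14 (prover-b2b-balaban-beta-d1-formalise-leaf-06-g14-0),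
2026-08-21 (journal INTENT 2 l.32673 + addendum A-d1leaf06g14-2 l.32844); no existing file touched.
-/

noncomputable section

namespace Summit.QuantumFields.BalabanUV.Beta.FP.PerfectMultiplierBlockLift

open Literature.Probability.LatticeModels (Torus.proj)
open Literature.MathematicalPhysics.QuantumFieldTheory
open Literature.MathematicalPhysics.QuantumFieldTheory.Balaban1983to89
open Literature.MathematicalPhysics.QuantumFieldTheory.Balaban1983to89.Beta
open LatticeForm (quo)
open ExpKernelCalculus (MKer)
open OneStepResolventKernel (Fib quo_zsmul proj_zsmul)
open OneStepKernelFamily (dec legSet legPt legW)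
open InterLevelTransport (lift liftW slot slotW lift_zsmul lift_off lift_inl_left lift_inl_right)
open Summit.QuantumFields.BalabanUV.Beta.HessKerDressedUnits (unitK unitK_apply legScale_inr)
open Summit.QuantumFields.BalabanUV.Beta.GAN24.CombesThomas (smStep sfStep)
open Summit.QuantumFields.BalabanUV.Beta.GAN24.CombesThomasFibre (eq_zsmul_quo_of_proj_eq_zero)
open Summit.QuantumFields.BalabanUV.Beta.GAN24.ScaleNesting (proj_mul_eq_zero_iff quo_mul)
open Summit.QuantumFields.BalabanUV.Beta.GAN24.TransverseDictionary (mmPart mmPart_inr_inr mmPart_inl_left mmPart_inl_right)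
open Summit.QuantumFields.BalabanUV.Beta.GAN24.EffectiveLaplacianLimit (deltaZLim)
open Summit.QuantumFields.BalabanUV.Beta.FP.PerfectObjects (KTot KTot_shift)
open Summit.QuantumFields.BalabanUV.Beta.FP.PerfectObjectsT (KPerf)
open Summit.QuantumFields.BalabanUV.Beta.FP.ConvergenceJMMultiplier (KTot_inr_inr)
open Summit.QuantumFields.BalabanUV.Beta.FP.PerfectSymbolKMultiplier (KPerf_inr_inr_eq KPerf_inr_inr_coarse)
open SecondOrderResponse (colM)

variable {d : ℕ}

/-! ## §1 Multiplier legs: decimation reads, the lift writes, at the coarse points -/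

section Legs

/-- [folklore] **ON MULTIPLIER LEGS THE BLOCK-CONTOUR DECIMATION IS EVALUATION AT THE COARSE POINTS**: `dec M K x′ y′ (inr κ) (inr l) = K (M•x′) (M•y′) (inr κ) (inr l)`
(`legSet (inr) = {(0,0)}`, `legW (inr) = 1`, `legPt (inr) x′ = M•x′`). -/
theorem dec_inr_inr (M : ℕ) (K : MKer (d + 1) (Fib d)) (x' y' : Fin (d + 1) → ℤ) (κ l : Fin (d + 1)) :
    dec M K x' y' (Sum.inr κ) (Sum.inr l) = K ((M : ℤ) • x') ((M : ℤ) • y') (Sum.inr κ) (Sum.inr l) := by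
  simp only [dec, legSet, legW, legPt, Finset.sum_singleton, one_mul]

/-- [folklore] **THE WEIGHTED LIFT WITH TWO MULTIPLIER SLOTS READS THE mm BLOCK** (`slotW false = 1`): at fine points on the `M`-lattice it is the mm entry of
`K` at the block indices, off the `M`-lattice it is `0`. -/
theorem liftW_false_false_inr_inr (M : ℕ) (K : MKer (d + 1) (Fib d)) (x y : Fin (d + 1) → ℤ) (κ l : Fin (d + 1)) :
    liftW M false false K x y (Sum.inr κ) (Sum.inr l)
      = if Torus.proj M x = 0 ∧ Torus.proj M y = 0 then K (quo M x) (quo M y) (Sum.inr κ) (Sum.inr l) else 0 := by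
  simp only [liftW, slotW, lift, slot, one_mul, Bool.false_eq_true, if_false]

variable {Lc : ℕ} [NeZero Lc]

/-- [folklore] Off the `Lc`-lattice ⟹ off the `Lc^(m+1)`-lattice. -/
theorem proj_pow_succ_ne (m : ℕ) {x : Fin (d + 1) → ℤ} (hx : Torus.proj Lc x ≠ 0) : Torus.proj (Lc ^ (m + 1)) x ≠ 0 := by
  intro h
  rw [pow_succ', proj_mul_eq_zero_iff] at h
  exact hx h.1

/-- [folklore] On the `Lc^(m+1)`-lattice: on the `Lc`-lattice, with the `Lc`-block index on the `Lc^m`-lattice, and the block indices compose. -/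
theorem proj_pow_succ_iff (m : ℕ) (x : Fin (d + 1) → ℤ) :
    Torus.proj (Lc ^ (m + 1)) x = 0 ↔ Torus.proj Lc x = 0 ∧ Torus.proj (Lc ^ m) (quo Lc x) = 0 := by
  rw [pow_succ', proj_mul_eq_zero_iff]

omit [NeZero Lc] in
/-- [folklore] `quo (Lc^m) (quo Lc x) = quo (Lc^(m+1)) x`. -/
theorem quo_pow_quo (m : ℕ) (x : Fin (d + 1) → ℤ) : quo (Lc ^ m) (quo Lc x) = quo (Lc ^ (m + 1)) x := by
  rw [pow_succ', quo_mul]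

/-- [folklore] The other nesting: `proj (Lc^(m+1)) x = 0 ↔ proj (Lc^m) x = 0 ∧ proj Lc (quo (Lc^m) x) = 0`, `quo Lc (quo (Lc^m) x) = quo (Lc^(m+1)) x`. -/
theorem proj_pow_succ_iff' (m : ℕ) (x : Fin (d + 1) → ℤ) :
    Torus.proj (Lc ^ (m + 1)) x = 0 ↔ Torus.proj (Lc ^ m) x = 0 ∧ Torus.proj Lc (quo (Lc ^ m) x) = 0 := by
  rw [pow_succ, proj_mul_eq_zero_iff]

omit [NeZero Lc] in
/-- [folklore] `quo Lc (quo (Lc^m) x) = quo (Lc^(m+1)) x`. -/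
theorem quo_quo_pow (m : ℕ) (x : Fin (d + 1) → ℤ) : quo Lc (quo (Lc ^ m) x) = quo (Lc ^ (m + 1)) x := by
  rw [pow_succ, quo_mul]

/-- [our object] **THE mm BLOCK OF THE `(j, m+1)`-RESOLVENT VANISHES OFF THE `Lc`-LATTICE** (either leg; leaf-06's `KTot_inr_inr`: it lives on the
`Lc^(m+1)`-coarse points). -/
theorem KTot_inr_inr_off_fine (j m : ℕ) {x y : Fin (d + 1) → ℤ} (h : Torus.proj Lc x ≠ 0 ∨ Torus.proj Lc y ≠ 0) (κ l : Fin (d + 1)) :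
    KTot (d := d) (Lc ^ (j + (m + 1))) (Lc ^ j) x y (Sum.inr κ) (Sum.inr l) = 0 := by
  rw [KTot_inr_inr, if_neg]
  rintro ⟨hx, hy⟩
  rcases h with h | h
  · exact proj_pow_succ_ne m h hx
  · exact proj_pow_succ_ne m h hy

end Legs

/-! ## §2 Finite level: the mm block of the `(j, m+1)`-resolvent IS the lifted mm block of the `(j+1, m)`-resolvent -/

section Finite

variable {Lc : ℕ} [NeZero Lc]

/-- [our object] **(K-mm) AT FINITE LEVEL, EXACT** (every `d`, `Lc ≥ 1`, `j`, `m`):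
`mmPart (KTot (Lc^(j+m+1)) (Lc^j)) = liftW Lc false false (KTot (Lc^(j+m+1)) (Lc^(j+1)))` — on the `Lc`-lattice both sides are the mm entry of the one-shot
inverse `KInv (Lc^(j+m+1))` at the same fine points (`KTot_shift` + `dec_inr_inr` + `x = Lc • quo Lc x`), off it both vanish (§1). NO correction term. -/
theorem mmPart_KTot_eq_liftW (j m : ℕ) :
    mmPart (KTot (d := d) (Lc ^ (j + m + 1)) (Lc ^ j)) = liftW Lc false false (KTot (d := d) (Lc ^ (j + m + 1)) (Lc ^ (j + 1))) := by
  funext x y a b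
  rcases a with α | κ
  · rw [mmPart_inl_left, liftW]; simp only [lift_inl_left, mul_zero]
  rcases b with β | l
  · rw [mmPart_inl_right, liftW]; simp only [lift_inl_right, mul_zero]
  rw [mmPart_inr_inr, liftW_false_false_inr_inr]
  by_cases h : Torus.proj Lc x = 0 ∧ Torus.proj Lc y = 0
  · rw [if_pos h, ← KTot_shift Lc j m, dec_inr_inr, ← eq_zsmul_quo_of_proj_eq_zero h.1, ← eq_zsmul_quo_of_proj_eq_zero h.2]
  · rw [if_neg h]
    have h' : Torus.proj Lc x ≠ 0 ∨ Torus.proj Lc y ≠ 0 := not_and_or.mp h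
    exact KTot_inr_inr_off_fine j m h' κ l

omit [NeZero Lc] in
/-- [folklore] The adopted multiplier unit squared is geometric with the `j`-FREE ratio `Lc^{2(d+1)}`: `s_m(j+1)² = Lc^{2(d+1)} · s_m(j)²`. -/
theorem smStep_succ_sq (j : ℕ) : smStep d Lc (j + 1) ^ 2 = (Lc : ℝ) ^ (2 * (d + 1)) * smStep d Lc j ^ 2 := by
  unfold smStep
  rw [← pow_mul, ← pow_mul, ← pow_add]
  congr 1
  ring

/-- [our object] **(K-mm) AT FINITE LEVEL IN THE ADOPTED UNITS** (levels `j` resp. `j+1` each in its OWN units `(sfStep Lc ·, smStep d Lc ·)`): the `j`-FREE factor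
`(Lc^{2(d+1)})⁻¹` appears — `mmPart (unitK_j (KTot (Lc^(j+m+1)) (Lc^j))) = (Lc^{2(d+1)})⁻¹ • liftW Lc false false (unitK_{j+1} (KTot (Lc^(j+m+1)) (Lc^(j+1))))`. -/
theorem mmPart_unitK_KTot_eq_liftW (j m : ℕ) :
    mmPart (unitK (sfStep Lc j) (smStep d Lc j) (KTot (d := d) (Lc ^ (j + m + 1)) (Lc ^ j)))
      = ((Lc : ℝ) ^ (2 * (d + 1)))⁻¹ •
          liftW Lc false false (unitK (sfStep Lc (j + 1)) (smStep d Lc (j + 1)) (KTot (d := d) (Lc ^ (j + m + 1)) (Lc ^ (j + 1)))) := by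
  have hL : (Lc : ℝ) ^ (2 * (d + 1)) ≠ 0 := pow_ne_zero _ (Nat.cast_ne_zero.2 (NeZero.ne Lc))
  have key := mmPart_KTot_eq_liftW (d := d) (Lc := Lc) j m
  funext x y a b
  rcases a with α | κ
  · simp only [mmPart_inl_left, Pi.smul_apply, smul_eq_mul, liftW, lift_inl_left, mul_zero]
  rcases b with β | l
  · simp only [mmPart_inl_right, Pi.smul_apply, smul_eq_mul, liftW, lift_inl_right, mul_zero]
  have hk := congrFun (congrFun (congrFun (congrFun key x) y) (Sum.inr κ)) (Sum.inr l)
  rw [mmPart_inr_inr, liftW_false_false_inr_inr] at hk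
  rw [mmPart_inr_inr, unitK_apply, legScale_inr, legScale_inr, Pi.smul_apply, Pi.smul_apply, Pi.smul_apply, Pi.smul_apply, smul_eq_mul,
    liftW_false_false_inr_inr, hk]
  split_ifs with h
  · rw [unitK_apply, legScale_inr, legScale_inr]
    have e : smStep d Lc (j + 1) * smStep d Lc (j + 1) = (Lc : ℝ) ^ (2 * (d + 1)) * (smStep d Lc j * smStep d Lc j) := by
      rw [← sq, ← sq, smStep_succ_sq]
    calc smStep d Lc j * KTot (d := d) (Lc ^ (j + m + 1)) (Lc ^ (j + 1)) (quo Lc x) (quo Lc y) (Sum.inr κ) (Sum.inr l) * smStep d Lc j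
        = (smStep d Lc j * smStep d Lc j) * KTot (d := d) (Lc ^ (j + m + 1)) (Lc ^ (j + 1)) (quo Lc x) (quo Lc y) (Sum.inr κ) (Sum.inr l) := by ring
      _ = ((Lc : ℝ) ^ (2 * (d + 1)))⁻¹ * ((smStep d Lc (j + 1) * smStep d Lc (j + 1)) *
            KTot (d := d) (Lc ^ (j + m + 1)) (Lc ^ (j + 1)) (quo Lc x) (quo Lc y) (Sum.inr κ) (Sum.inr l)) := by
          rw [e]; field_simp
      _ = ((Lc : ℝ) ^ (2 * (d + 1)))⁻¹ * (smStep d Lc (j + 1) *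
            KTot (d := d) (Lc ^ (j + m + 1)) (Lc ^ (j + 1)) (quo Lc x) (quo Lc y) (Sum.inr κ) (Sum.inr l) * smStep d Lc (j + 1)) := by ring
  · simp

end Finite

/-! ## §3 Perfect level (`d + 1 = 4`, `Lc ≥ 2`): BOTTOM and TOP lifts, EXACT -/

section Perfect

variable {Lc : ℕ} [NeZero Lc]

/-- [our object] **(K-mm) AT THE PERFECT OBJECTS, BOTTOM FORM** (`d + 1 = 4`, `2 ≤ Lc`, every `m`; UNCONDITIONAL):
`mmPart (KPerf Lc (sfStep Lc) (smStep 3 Lc) (m+1)) = (Lc⁸)⁻¹ • liftW Lc false false (KPerf Lc (sfStep Lc) (smStep 3 Lc) m)` — the mm block of the `(m+1)`-fold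
perfect resolvent IS the `m`-fold one lifted from the `Lc`-lattice, times the one-step multiplier unit `Lc^{−2(d+1)} = Lc⁻⁸` (gan24-p3's explicit symbol
`KPerf_inr_inr_eq`: both sides are `(2∕Lc^{8(m+1)})·Δ_∞` at the `Lc^(m+1)`-coarse points and `0` elsewhere).  NO deviation words: `D_mm m = 0`. -/
theorem mmPart_KPerf_succ_eq_liftW (hLc : 2 ≤ Lc) (m : ℕ) :
    mmPart (KPerf (d := 3) Lc (sfStep Lc) (smStep 3 Lc) (m + 1))
      = (((Lc : ℝ) ^ 8)⁻¹) • liftW Lc false false (KPerf (d := 3) Lc (sfStep Lc) (smStep 3 Lc) m) := by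
  have hL : (Lc : ℝ) ≠ 0 := Nat.cast_ne_zero.2 (NeZero.ne Lc)
  funext x y a b
  rcases a with α | κ
  · simp only [mmPart_inl_left, Pi.smul_apply, smul_eq_mul, liftW, lift_inl_left, mul_zero]
  rcases b with β | l
  · simp only [mmPart_inl_right, Pi.smul_apply, smul_eq_mul, liftW, lift_inl_right, mul_zero]
  simp only [Pi.smul_apply, smul_eq_mul]
  rw [mmPart_inr_inr, liftW_false_false_inr_inr, KPerf_inr_inr_eq hLc (m + 1)]
  by_cases h : Torus.proj Lc x = 0 ∧ Torus.proj Lc y = 0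
  · rw [if_pos h, KPerf_inr_inr_eq hLc m, quo_pow_quo, quo_pow_quo]
    by_cases h' : Torus.proj (Lc ^ m) (quo Lc x) = 0 ∧ Torus.proj (Lc ^ m) (quo Lc y) = 0
    · rw [if_pos h', if_pos ⟨(proj_pow_succ_iff m x).2 ⟨h.1, h'.1⟩, (proj_pow_succ_iff m y).2 ⟨h.2, h'.2⟩⟩, pow_succ]
      field_simp
      ring
    · rw [if_neg h', mul_zero, if_neg]
      rintro ⟨hx, hy⟩
      exact h' ⟨((proj_pow_succ_iff m x).1 hx).2, ((proj_pow_succ_iff m y).1 hy).2⟩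
  · rw [if_neg h, mul_zero, if_neg]
    rintro ⟨hx, hy⟩
    exact h ⟨((proj_pow_succ_iff m x).1 hx).1, ((proj_pow_succ_iff m y).1 hy).1⟩

/-- [our object] **(K-mm) AT THE PERFECT OBJECTS, TOP FORM** (`d + 1 = 4`, `2 ≤ Lc`, every `m`; UNCONDITIONAL):
`mmPart (KPerf … (m+1)) = (Lc^{8m})⁻¹ • liftW (Lc^m) false false (KPerf … 1)` — the ONE-step perfect multiplier block lifted from the `Lc^m`-lattice. -/
theorem mmPart_KPerf_succ_eq_liftW_one (hLc : 2 ≤ Lc) (m : ℕ) :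
    mmPart (KPerf (d := 3) Lc (sfStep Lc) (smStep 3 Lc) (m + 1))
      = ((((Lc : ℝ) ^ m) ^ 8)⁻¹) • liftW (Lc ^ m) false false (KPerf (d := 3) Lc (sfStep Lc) (smStep 3 Lc) 1) := by
  have hL : (Lc : ℝ) ≠ 0 := Nat.cast_ne_zero.2 (NeZero.ne Lc)
  funext x y a b
  rcases a with α | κ
  · simp only [mmPart_inl_left, Pi.smul_apply, smul_eq_mul, liftW, lift_inl_left, mul_zero]
  rcases b with β | l
  · simp only [mmPart_inl_right, Pi.smul_apply, smul_eq_mul, liftW, lift_inl_right, mul_zero]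
  simp only [Pi.smul_apply, smul_eq_mul]
  rw [mmPart_inr_inr, liftW_false_false_inr_inr, KPerf_inr_inr_eq hLc (m + 1)]
  by_cases h : Torus.proj (Lc ^ m) x = 0 ∧ Torus.proj (Lc ^ m) y = 0
  · rw [if_pos h, KPerf_inr_inr_eq hLc 1, pow_one, quo_quo_pow, quo_quo_pow]
    by_cases h' : Torus.proj Lc (quo (Lc ^ m) x) = 0 ∧ Torus.proj Lc (quo (Lc ^ m) y) = 0
    · rw [if_pos h', if_pos ⟨(proj_pow_succ_iff' m x).2 ⟨h.1, h'.1⟩, (proj_pow_succ_iff' m y).2 ⟨h.2, h'.2⟩⟩, pow_succ]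
      field_simp
      ring
    · rw [if_neg h', mul_zero, if_neg]
      rintro ⟨hx, hy⟩
      exact h' ⟨((proj_pow_succ_iff' m x).1 hx).2, ((proj_pow_succ_iff' m y).1 hy).2⟩
  · rw [if_neg h, mul_zero, if_neg]
    rintro ⟨hx, hy⟩
    exact h ⟨((proj_pow_succ_iff' m x).1 hx).1, ((proj_pow_succ_iff' m y).1 hy).1⟩

/-- [our object] **SELF-SIMILARITY AT THE COARSE POINTS**: `[KPerf … (m+1)]_mm (Lc^(m+1)•u, Lc^(m+1)•u′) = (Lc⁸)⁻ᵐ · [KPerf … 1]_mm (Lc•u, Lc•u′)` — in block units ONE kernel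
`2·Δ_∞` for every `m` (gan24-p3's `KPerf_inr_inr_coarse`, read as the two-level relation the Fubini expansion uses). -/
theorem KPerf_succ_inr_inr_coarse (hLc : 2 ≤ Lc) (m : ℕ) (u u' : Fin (3 + 1) → ℤ) (κ l : Fin (3 + 1)) :
    KPerf (d := 3) Lc (sfStep Lc) (smStep 3 Lc) (m + 1) (((Lc ^ (m + 1) : ℕ) : ℤ) • u) (((Lc ^ (m + 1) : ℕ) : ℤ) • u') (Sum.inr κ) (Sum.inr l)
      = ((((Lc : ℝ) ^ m) ^ 8)⁻¹) *
          KPerf (d := 3) Lc (sfStep Lc) (smStep 3 Lc) 1 (((Lc : ℕ) : ℤ) • u) (((Lc : ℕ) : ℤ) • u') (Sum.inr κ) (Sum.inr l) := by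
  have hL : (Lc : ℝ) ≠ 0 := Nat.cast_ne_zero.2 (NeZero.ne Lc)
  rw [KPerf_inr_inr_eq hLc (m + 1), if_pos ⟨proj_zsmul u, proj_zsmul u'⟩, quo_zsmul, quo_zsmul, KPerf_inr_inr_eq hLc 1]
  have e1 : Torus.proj (Lc ^ 1) (((Lc : ℕ) : ℤ) • u) = 0 := by rw [pow_one]; exact proj_zsmul u
  have e2 : Torus.proj (Lc ^ 1) (((Lc : ℕ) : ℤ) • u') = 0 := by rw [pow_one]; exact proj_zsmul u'
  have q1 : quo (Lc ^ 1) (((Lc : ℕ) : ℤ) • u) = u := by rw [pow_one]; exact quo_zsmul u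
  have q2 : quo (Lc ^ 1) (((Lc : ℕ) : ℤ) • u') = u' := by rw [pow_one]; exact quo_zsmul u'
  rw [if_pos ⟨e1, e2⟩, q1, q2, pow_one, pow_succ]
  field_simp
  ring

end Perfect

/-! ## §4 The multiplier columns of the perfect resolvents are self-similar -/

section Columns

variable {Lc : ℕ} [NeZero Lc]

/-- [our object] **THE MULTIPLIER COLUMNS OF THE PERFECT RESOLVENTS ARE SELF-SIMILAR** (`d + 1 = 4`, `2 ≤ Lc`, every `m`; UNCONDITIONAL): in an1's currency
`SecondOrderResponse.colM K N μ y ρ w = K (N•w) (N•y) (inr ρ) (inr μ)` (the multiplier column feeding `vertexOfM` ∕ `dM` ∕ `K2OfK` ∕ `W2OfK`),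
`colM (KPerf … (m+1)) (Lc^(m+1)) μ y ρ w = (Lc⁸)⁻¹ · colM (KPerf … m) (Lc^m) μ y ρ w` — one more step costs exactly one factor `Lc⁻⁸` and NOTHING ELSE. -/
theorem colM_KPerf_succ (hLc : 2 ≤ Lc) (m : ℕ) (μ : Fin (3 + 1)) (y : Fin (3 + 1) → ℤ) (ρ : Fin (3 + 1)) (w : Fin (3 + 1) → ℤ) :
    colM (KPerf (d := 3) Lc (sfStep Lc) (smStep 3 Lc) (m + 1)) (Lc ^ (m + 1)) μ y ρ w
      = (((Lc : ℝ) ^ 8)⁻¹) * colM (KPerf (d := 3) Lc (sfStep Lc) (smStep 3 Lc) m) (Lc ^ m) μ y ρ w := by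
  have hL : (Lc : ℝ) ≠ 0 := Nat.cast_ne_zero.2 (NeZero.ne Lc)
  unfold colM
  rw [KPerf_inr_inr_coarse hLc (m + 1), KPerf_inr_inr_coarse hLc m, pow_succ]
  field_simp
  ring

/-- [our object] … iterated down to the one-step perfect resolvent: `colM (KPerf … (m+1)) (Lc^(m+1)) μ y ρ w = (Lc^{8m})⁻¹ · colM (KPerf … 1) Lc μ y ρ w`. -/
theorem colM_KPerf_succ_eq_one (hLc : 2 ≤ Lc) (m : ℕ) (μ : Fin (3 + 1)) (y : Fin (3 + 1) → ℤ) (ρ : Fin (3 + 1)) (w : Fin (3 + 1) → ℤ) :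
    colM (KPerf (d := 3) Lc (sfStep Lc) (smStep 3 Lc) (m + 1)) (Lc ^ (m + 1)) μ y ρ w
      = ((((Lc : ℝ) ^ m) ^ 8)⁻¹) * colM (KPerf (d := 3) Lc (sfStep Lc) (smStep 3 Lc) 1) Lc μ y ρ w := by
  have h := KPerf_succ_inr_inr_coarse (Lc := Lc) hLc m w y ρ μ
  unfold colM
  simpa only [pow_one, Nat.cast_pow] using h

end Columns

end Summit.QuantumFields.BalabanUV.Beta.FP.PerfectMultiplierBlockLift

end
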